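import Summits.QuantumFields.YangMills.Theorems.UnitScaleTiltProp7CurvedMemberGradientRow
import HarnessLib

/-!
# Route `UnitScaleTilt`, crux K1 «MinimiserStabilityRegPr» (stmt-QuantumFields-19200), EX face — EX row `hPcol`, brick **T1 §1–§2: THE SUP→SUP GRADIENT ROW OF A COVARIANT
# POISSON-TYPE EQUATION AT A REGULAR BACKGROUND** — for ANY site fields `u, q` with `Δ^η_{U₀}u + q = 0` (`= D*_{U₀}0`) and GLOBAL sup letters `‖u‖_∞ ≤ M_u`, `‖q‖_∞ ≤ M_q`:
# `‖(D_{U₀}u)(p)‖ ≤ 2·(C_g·(M_u·(2 + 2√2·4ε₀(3 + 2457C) + (24√10 + 48)(48ε₀)²) + M_q) + 2√2·48ε₀·M_u)` at every bond — the `κ = 0` edition of (ii-b) ✓p764378 `perBond_gradient_le` ∕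
# `column_gradient_decay` with NO LOD letters (no `Q″ ι T G`): same transport to the torus axial gauge `V := U₀^{axialT U₀ c}` (px10 ✓p764004), same (G1-3a) ✓p763385 call fed
# by the chart glue ✓p763682 and the ball letters ✓p764285, same read-back ✓`norm_DL2_le`, and the two-line max absorption over the finite bond set (px12 g15 ✓p763767
# `weighted_sup_absorption` at `κ = d = D := 0`).  (px5 g12 ■ FINAL 07:17Z «T1 = the one missing brick of hPcol»; px12 g16 07:21Z claim + first refusal; px19 g13 07:21Z split:
# §1–§2 here, §3 = T1 proper at `u := G_a f` in V2's letters — px12 g16.)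

Cell `ym3-torus` (YM ladder rung R3 = continuum SU(2) Yang–Mills on T³ — a RUNG, NOT the Clay problem: not d = 4, not infinite volume, not a mass gap);
width seat `ym3-torus-px19` (gen 13); helper `--supports stmt-QuantumFields-19200`.  THEOREMS ONLY (0 `def`, 0 `sorry`, default heartbeats).

* §1 ★★ `perBond_gradient_le_of_sup` — per bond `p`: `‖(D_{U₀}u)(p)‖ ≤ M₀ + C_g·(48ε₀(6√2√10 + 6√2))·G_b` for every GLOBAL bound `G_b` of `‖D_{U₀}u‖`, `M₀` as displayed.
* §2 ★★★ `norm_equiv_DL2_le_of_sup` — `‖(D_{U₀}u)(p)‖ ≤ 2·M₀` under the absorption margin `C_g·(48ε₀(6√2√10 + 6√2)) ≤ ½`.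
HYP-SAT (★★OWNER RULING №42): hypotheses = `RegPr` (both clauses of print's (8)), `0 < ε₀ ≤ 1`, the equation (an equality), two real sup letters (inhabited by the finite maxima at fixed
data; K-free on the LOD solutions by V2's rows — §3, px12 g16), `hroom` (no-wrap room, CHAIR WORD №1 class: members without room go through the cover), `hsmall` (smallness of `ε₀` vs the
universal `C_g`).  Conclusion non-vacuous; no `Prop` hypothesis.  HONEST SCOPE: composition; nothing of T1 §3, `hPcol`, `h349`, the ten EX rows, EX, 19200 or the rung is proved here;
the Yang–Mills mass gap is NOT proved.

References: T. Bałaban, CMP **99** (1985) 389–434 [Balaban1985BackgroundPropagators] ((3.3) p.391, (3.23)–(3.24) p.394, Thm 3.1 (3.43)–(3.47) p.398); CMP **98** (1985) 17–51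
[Balaban1985Averaging] ((19) p.21, pp.24–25); CMP **102** (1985) 277–309 [Balaban1985Variational] ((2), (8) p.278).
-/

set_option autoImplicit false

noncomputable section

open scoped BigOperators Matrix.Norms.L2Operator InnerProductSpace ComplexConjugate

namespace Summit.QuantumFields.YangMills.Theorems.Prop7MassiveSolutionGradientSup

open Literature.MathematicalPhysics.QuantumFieldTheory.Balaban1983to89
open Literature.MathematicalPhysics.QuantumFieldTheory.Balaban1983to89.T3ContinuumYM3Torus
open B10Eq27TorusAxialLog (axialT)
open B4Sect5Torus (TSite tdist tdist_triangle tdist_self tdist_nonneg)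
open B9SectCLatticeCarrier (Bond shift tdist_shift_le)
open B9Eq311L2Pairing (WL2)
open B11Eq103H1Complex (SiteL2K BondL2K)
open T3RegularMinimiser (regThreshold)
open T3PrintedRegularMinimiser (RegPr)
open Summit.QuantumFields.YangMills.Theorems.Prop7SectET3Transport (periodsT3 siteEquiv bgOfCfg)
open Summit.QuantumFields.YangMills.Theorems.Prop7SectET3HilbertLetters (W₂ DL2 DstarL2 covLapSite)
open Summit.QuantumFields.YangMills.Theorems.Prop7TwoBackgroundGradientComparison (one_le_periodsT3 norm_DL2_le)
open Summit.QuantumFields.YangMills.Theorems.Prop7CurvedMemberLocalGradient (exists_curved_localGradient)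
open Summit.QuantumFields.YangMills.Theorems.Prop7WeightedGradientAbsorption (weighted_sup_absorption)
open Summit.QuantumFields.YangMills.Theorems.Prop7GaugeCovariancePointwise (exists_adIsometries_pointwise ell_mul_norm_sub_le_of_rows memberEquation_gaugeAct)
open Summit.QuantumFields.YangMills.Theorems.AxialGaugeChartGlue (norm_bgOfCfg_axialT_sub_le)
open Summit.QuantumFields.YangMills.Theorems.Prop7CurvedMemberBallLetters (natCast_radius norm_bgOfCfg_axialT_sub_one_le_of_ball ell_mul_delta_ball_le ell_mul_theta_ball_le)
open Summit.QuantumFields.YangMills.Theorems.Prop7CurvedMemberGradientRow (regroup_bracket)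

variable (F : T3Family) (n K : ℕ) {ε₀ : ℝ} (hε₀ : 0 < ε₀) (hε1 : ε₀ ≤ 1)
  (U₀ : GaugeField (F.P K) 0 (Matrix.specialUnitaryGroup (Fin 2) ℂ)) (hreg : RegPr F n K ε₀ U₀)
  (c₀ : ℝ) [Fact (0 < c₀)]

/-! ## §1 The per-bond letter with global sups -/

include hε₀ hε1 hreg in
/-- ★★ **THE PER-BOND GRADIENT LETTER OF A COVARIANT POISSON-TYPE EQUATION WITH GLOBAL SUP LETTERS.**  For `u q` with `Δ^η_{U₀}u + q = D*_{U₀}0`, `‖u(x)‖ ≤ M_u`, `‖q(x)‖ ≤ M_q`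
everywhere, the no-wrap room at `R = 12ℓ + 4`, and every GLOBAL bound `G_b` of `‖(D_{U₀}u)(·)‖`: at every bond `p`,
`‖(D_{U₀}u)(p)‖ ≤ (C_g·(M_u·(2 + 2√2·4ε₀(3 + 2457C) + (24√10 + 48)(48ε₀)²) + M_q) + 2√2·48ε₀·M_u) + C_g·(48ε₀(6√2√10 + 6√2))·G_b`
(`C_g := exists_curved_localGradient.choose`, `C := norm_bgOfCfg_axialT_sub_le.choose`).  Proof = (ii-b)'s `perBond_gradient_le` at `κ = 0`: gauge `V := U₀^{axialT U₀ (e⁻¹ p.1)}`,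
`Φ∕Ψ` (✓`exists_adIsometries_pointwise`), transported equation, `G := G_b + 2√2·48ε₀·M_u`, (G1-3a) at `(V, Φu, Φq, 0, p.1)`, read-back, ✓`regroup_bracket`.
[cite: Balaban1985BackgroundPropagators, Thm 3.1 (3.43)–(3.47) p.398; Balaban1985Averaging, pp.24-25] -/
theorem perBond_gradient_le_of_sup (u q : SiteL2K ℂ 3 (periodsT3 F K) c₀ W₂)
    (h : covLapSite F n K c₀ U₀ u + q = DstarL2 F n K c₀ U₀ 0) {Mu Mq : ℝ} (hMu0 : 0 ≤ Mu) (hMq0 : 0 ≤ Mq)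
    (hMu : ∀ x : TSite 3 (periodsT3 F K), ‖WL2.equiv ℂ (fun _ : TSite 3 (periodsT3 F K) => c₀) W₂ u x‖ ≤ Mu)
    (hMq : ∀ x : TSite 3 (periodsT3 F K), ‖WL2.equiv ℂ (fun _ : TSite 3 (periodsT3 F K) => c₀) W₂ q x‖ ≤ Mq)
    (hroom : 2 * (12 * F.L ^ (K - n) + 5) ≤ (F.P K).sitesPerDir 0)
    (p : Bond 3 (periodsT3 F K)) (Gb : ℝ)
    (hGb : ∀ p' : Bond 3 (periodsT3 F K), ‖WL2.equiv ℂ (fun _ : Bond 3 (periodsT3 F K) => c₀) W₂ (DL2 F n K c₀ U₀ u) p'‖ ≤ Gb) :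
    ‖WL2.equiv ℂ (fun _ : Bond 3 (periodsT3 F K) => c₀) W₂ (DL2 F n K c₀ U₀ u) p‖
      ≤ (exists_curved_localGradient.choose *
            (Mu * (2 + 2 * Real.sqrt 2 * (4 * ε₀ * (3 + 2457 * norm_bgOfCfg_axialT_sub_le.choose)) + (24 * Real.sqrt 10 + 48) * (48 * ε₀) ^ 2) + Mq)
          + 2 * Real.sqrt 2 * (48 * ε₀) * Mu)
        + exists_curved_localGradient.choose * ((48 * ε₀) * (6 * Real.sqrt 2 * Real.sqrt 10 + 6 * Real.sqrt 2)) * Gb := by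
  classical
  -- the two universal constants
  obtain ⟨hCg0, hG13a⟩ := exists_curved_localGradient.choose_spec
  set Cg : ℝ := exists_curved_localGradient.choose with hCg
  obtain ⟨hC0, hΘrow⟩ := norm_bgOfCfg_axialT_sub_le.choose_spec
  set C : ℝ := norm_bgOfCfg_axialT_sub_le.choose with hCdef
  clear_value Cg C
  -- scales and radius
  have hP1 : ∀ i, 1 ≤ periodsT3 F K i := one_le_periodsT3 F K
  have hL1 : (1 : ℝ) ≤ (F.L : ℝ) := by have := F.hL.2; exact_mod_cast this.le
  have hℓ1 : (1 : ℝ) ≤ (F.L : ℝ) ^ (K - n) := one_le_pow₀ hL1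
  have hℓ0 : (0 : ℝ) < (F.L : ℝ) ^ (K - n) := by positivity
  set R : ℕ := 12 * F.L ^ (K - n) + 4 with hRdef
  have hRℝ : (R : ℝ) = 12 * (F.L : ℝ) ^ (K - n) + 4 := natCast_radius F n K
  have hroom' : 2 * (R + 1) ≤ (F.P K).sitesPerDir 0 := by rw [hRdef]; omega
  have hε0 : 0 ≤ ε₀ := hε₀.le
  -- the bond, the gauge, the isometries
  set c : Site (F.P K) 0 := (siteEquiv F K).symm p.1 with hc
  set x : TSite 3 (periodsT3 F K) := siteEquiv F K c with hx
  have hxp : x = p.1 := by rw [hx, hc, Equiv.apply_symm_apply]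
  set V : GaugeField (F.P K) 0 (Matrix.specialUnitaryGroup (Fin 2) ℂ) := GaugeField.gaugeAct (axialT U₀ c) U₀ with hV
  obtain ⟨Φ, Ψ, -, -, hP1Φ, -, hU⟩ := exists_adIsometries_pointwise F n K c₀ (axialT U₀ c)
  obtain ⟨-, hDstar, hΔ, hDpt, -, -⟩ := hU U₀
  -- the transported equation
  have htrans : covLapSite F n K c₀ V (Φ u) + Φ q = DstarL2 F n K c₀ V 0 := by
    have := memberEquation_gaugeAct F n K c₀ (axialT U₀ c) U₀ Φ Ψ hDstar hΔ h
    simpa only [map_zero] using this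
  -- the sup letters transport pointwise
  have hMuV : ∀ z, ‖WL2.equiv ℂ (fun _ : TSite 3 (periodsT3 F K) => c₀) W₂ (Φ u) z‖ ≤ Mu := fun z => by rw [hP1Φ]; exact hMu z
  have hMqV : ∀ z, ‖WL2.equiv ℂ (fun _ : TSite 3 (periodsT3 F K) => c₀) W₂ (Φ q) z‖ ≤ Mq := fun z => by rw [hP1Φ]; exact hMq z
  -- the background rows of `V` : `δ` on the big ball, `Θ` on the `4ℓ`-ball
  set δ : ℝ := 3 * (R : ℝ) * regThreshold F n K ε₀ with hδdef
  have hδ0 : 0 ≤ δ := by rw [hδdef]; unfold regThreshold; positivity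
  have hδBall : ∀ (z : TSite 3 (periodsT3 F K)) (μ : Fin 3), tdist (periodsT3 F K) x z ≤ 12 * (F.L : ℝ) ^ (K - n) + 4 →
      ‖((bgOfCfg F K V (z, μ) : (Matrix (Fin 2) (Fin 2) ℂ)ˣ) : Matrix (Fin 2) (Fin 2) ℂ) - 1‖ ≤ δ := by
    intro z μ hz
    exact norm_bgOfCfg_axialT_sub_one_le_of_ball F n K hε0 U₀ hreg.1 c hroom' z μ (by rw [hRℝ]; exact hz)
  have hℓδ : (F.L : ℝ) ^ (K - n) * δ ≤ 48 * ε₀ := by rw [hδdef]; exact ell_mul_delta_ball_le F n K hε0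
  set Θ : ℝ := (3 * (ε₀ * ((F.L : ℝ)⁻¹) ^ (2 * (K - n))) + (3 : ℝ) ^ 2 * (C * ((ε₀ * ((F.L : ℝ)⁻¹) ^ (2 * (K - n))) +
      R * (ε₀ * ((F.L : ℝ)⁻¹) ^ (3 * (K - n))) + (R : ℝ) ^ 2 * (ε₀ * ((F.L : ℝ)⁻¹) ^ (2 * (K - n))) ^ 2))) * Real.sqrt ((R : ℝ) * (F.L : ℝ) ^ (K - n)) with hΘdef
  have hΘ0 : 0 ≤ Θ := by
    have : (0 : ℝ) ≤ ((F.L : ℝ)⁻¹) := inv_nonneg.2 (Nat.cast_nonneg _)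
    positivity
  have hΘBall := hΘrow F n K ε₀ hε0 hε1 U₀ hreg.1 hreg.2 c x 0 R (by rw [hx, B4Sect5Torus.tdist_self]; norm_num) (by omega) hroom'
  have hℓΘ : (F.L : ℝ) ^ (K - n) * Θ ≤ 4 * ε₀ * (3 + 2457 * C) := by rw [hΘdef]; exact ell_mul_theta_ball_le F n K hε0 hε1 hC0
  -- the η-GRADIENT LETTER `G := G_b + 2√2·(48ε₀)·M_u`
  have hGb0 : 0 ≤ Gb := (norm_nonneg _).trans (hGb p)
  set Gt : ℝ := Gb + 2 * Real.sqrt 2 * (48 * ε₀) * Mu with hGt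
  have hGt0 : 0 ≤ Gt := by positivity
  have hGBall : ∀ (z : TSite 3 (periodsT3 F K)) (μ : Fin 3), tdist (periodsT3 F K) x z ≤ 12 * (F.L : ℝ) ^ (K - n) + 3 →
      (F.L : ℝ) ^ (K - n) * ‖WL2.equiv ℂ (fun _ : TSite 3 (periodsT3 F K) => c₀) W₂ (Φ u) (shift μ z) -
        WL2.equiv ℂ (fun _ : TSite 3 (periodsT3 F K) => c₀) W₂ (Φ u) z‖ ≤ Gt := by
    intro z μ hz
    have hcov : ‖WL2.equiv ℂ (fun _ : Bond 3 (periodsT3 F K) => c₀) W₂ (DL2 F n K c₀ V (Φ u)) (z, μ)‖ ≤ Gb := by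
      rw [hV, hDpt]; exact hGb (z, μ)
    have h1 := ell_mul_norm_sub_le_of_rows F n K c₀ V (Φ u) z μ hcov (hδBall z μ (by linarith only [hz])) (hMuV _)
    calc _ ≤ Gb + 2 * Real.sqrt 2 * ((F.L : ℝ) ^ (K - n) * δ) * Mu := h1
      _ ≤ Gb + 2 * Real.sqrt 2 * (48 * ε₀) * Mu :=
          add_le_add le_rfl (mul_le_mul_of_nonneg_right (mul_le_mul_of_nonneg_left hℓδ (by positivity : (0 : ℝ) ≤ 2 * Real.sqrt 2)) hMu0)
  -- (G1-3a) at `(V, Φu, Φq, 0, x)` with `M_f = H_f := 0`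
  have h13 := hG13a F n K c₀ V (Φ u) (Φ q) 0 x Mu Gt 0 0 Mq δ Θ hMu0 hGt0 le_rfl le_rfl hMq0 hδ0 hΘ0 htrans
    (fun z _ => hMuV z) hGBall
    (fun z μ _ => by rw [WL2.equiv_zero, Pi.zero_apply, norm_zero])
    (fun z z' μ _ _ => by rw [WL2.equiv_zero, Pi.zero_apply, Pi.zero_apply, sub_self, norm_zero, zero_mul])
    (fun z _ => hMqV z) (fun z μ hz => hδBall z μ (by linarith only [hz, hℓ1])) hΘBall p.2
  -- read back `g(p) = ‖(D_V Φu)(x, p.2)‖`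
  have hread : ‖WL2.equiv ℂ (fun _ : Bond 3 (periodsT3 F K) => c₀) W₂ (DL2 F n K c₀ U₀ u) p‖
      ≤ (F.L : ℝ) ^ (K - n) * ‖WL2.equiv ℂ (fun _ : TSite 3 (periodsT3 F K) => c₀) W₂ (Φ u) (shift p.2 x) -
          WL2.equiv ℂ (fun _ : TSite 3 (periodsT3 F K) => c₀) W₂ (Φ u) x‖ + 2 * Real.sqrt 2 * (48 * ε₀) * Mu := by
    have hp : p = (x, p.2) := by rw [hxp]
    rw [hp, ← hDpt, ← hV]
    have hx0 : tdist (periodsT3 F K) x x ≤ 12 * (F.L : ℝ) ^ (K - n) + 4 := by rw [B4Sect5Torus.tdist_self]; positivity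
    have h1 := norm_DL2_le n V (Φ u) x p.2
    have h2 : 2 * Real.sqrt 2 * ‖((bgOfCfg F K V (x, p.2) : (Matrix (Fin 2) (Fin 2) ℂ)ˣ) : Matrix (Fin 2) (Fin 2) ℂ) - 1‖
        * ‖WL2.equiv ℂ (fun _ : TSite 3 (periodsT3 F K) => c₀) W₂ (Φ u) (shift p.2 x)‖ ≤ 2 * Real.sqrt 2 * δ * Mu :=
      mul_le_mul (mul_le_mul_of_nonneg_left (hδBall x p.2 hx0) (by positivity)) (hMuV _) (norm_nonneg _) (by positivity)
    have h3 : (F.L : ℝ) ^ (K - n) * (2 * Real.sqrt 2 * δ * Mu) ≤ 2 * Real.sqrt 2 * (48 * ε₀) * Mu := by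
      have := mul_le_mul_of_nonneg_right (mul_le_mul_of_nonneg_left hℓδ (by positivity : (0 : ℝ) ≤ 2 * Real.sqrt 2)) hMu0
      calc (F.L : ℝ) ^ (K - n) * (2 * Real.sqrt 2 * δ * Mu) = 2 * Real.sqrt 2 * ((F.L : ℝ) ^ (K - n) * δ) * Mu := by ring
        _ ≤ _ := this
    calc _ ≤ (F.L : ℝ) ^ (K - n) * (‖WL2.equiv ℂ (fun _ : TSite 3 (periodsT3 F K) => c₀) W₂ (Φ u) (shift p.2 x) -
              WL2.equiv ℂ (fun _ : TSite 3 (periodsT3 F K) => c₀) W₂ (Φ u) x‖ + 2 * Real.sqrt 2 * δ * Mu) :=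
          h1.trans (mul_le_mul_of_nonneg_left (add_le_add le_rfl h2) hℓ0.le)
      _ = _ := mul_add _ _ _
      _ ≤ _ := add_le_add le_rfl h3
  -- regroup
  have hkey := hread.trans (add_le_add h13 le_rfl)
  have hreg' := regroup_bracket (Cg := Cg) (Mu := Mu) (Mq := Mq) (Gb := Gb) hCg0 hMu0 hGb0 (mul_nonneg hℓ0.le hδ0) (mul_nonneg hℓ0.le hΘ0) hℓδ hℓΘ
  have hfin : Cg * (Mu + (0 + 2 * Real.sqrt 2 * ((F.L : ℝ) ^ (K - n) * Θ * Mu + (F.L : ℝ) ^ (K - n) * δ * (3 * Real.sqrt 10 * Gt)))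
        + (6 * Real.sqrt 2 * ((F.L : ℝ) ^ (K - n) * δ) * (0 + Gt + 2 * Real.sqrt 2 * ((F.L : ℝ) ^ (K - n) * δ) * Mu) + Mu + Mq))
      + 2 * Real.sqrt 2 * (48 * ε₀) * Mu
      ≤ (Cg * (Mu * (2 + 2 * Real.sqrt 2 * (4 * ε₀ * (3 + 2457 * C)) + (24 * Real.sqrt 10 + 48) * (48 * ε₀) ^ 2) + Mq) + 2 * Real.sqrt 2 * (48 * ε₀) * Mu)
        + Cg * ((48 * ε₀) * (6 * Real.sqrt 2 * Real.sqrt 10 + 6 * Real.sqrt 2)) * Gb := by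
    rw [hGt]
    exact hreg'
  exact hkey.trans hfin

/-! ## §2 ★★★ The sup→sup gradient row -/

include hε₀ hε1 hreg in
/-- ★★★ **THE SUP→SUP GRADIENT ROW** ([Balaban1985BackgroundPropagators] Thm 3.1 (3.43)–(3.44), sup edition at a regular curved background).  For `u q` with `Δ^η_{U₀}u + q = D*_{U₀}0`
on the torus, `‖u‖_∞ ≤ M_u`, `‖q‖_∞ ≤ M_q`, the no-wrap room and the absorption margin `C_g·(48ε₀(6√2√10 + 6√2)) ≤ ½`:
`‖(D_{U₀}u)(p)‖ ≤ 2·(C_g·(M_u·(2 + 2√2·4ε₀(3 + 2457C) + (24√10 + 48)(48ε₀)²) + M_q) + 2√2·48ε₀·M_u)` at EVERY bond `p` — §1 with `G_b := ‖D_{U₀}u‖_∞`, absorbed by the max over the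
finite bond set (✓`weighted_sup_absorption` at `κ = d = D := 0`). [cite: Balaban1985BackgroundPropagators, Thm 3.1 (3.42)–(3.44) pp.397–398] -/
theorem norm_equiv_DL2_le_of_sup (u q : SiteL2K ℂ 3 (periodsT3 F K) c₀ W₂)
    (h : covLapSite F n K c₀ U₀ u + q = DstarL2 F n K c₀ U₀ 0) {Mu Mq : ℝ} (hMu0 : 0 ≤ Mu) (hMq0 : 0 ≤ Mq)
    (hMu : ∀ x : TSite 3 (periodsT3 F K), ‖WL2.equiv ℂ (fun _ : TSite 3 (periodsT3 F K) => c₀) W₂ u x‖ ≤ Mu)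
    (hMq : ∀ x : TSite 3 (periodsT3 F K), ‖WL2.equiv ℂ (fun _ : TSite 3 (periodsT3 F K) => c₀) W₂ q x‖ ≤ Mq)
    (hroom : 2 * (12 * F.L ^ (K - n) + 5) ≤ (F.P K).sitesPerDir 0)
    (hsmall : exists_curved_localGradient.choose * ((48 * ε₀) * (6 * Real.sqrt 2 * Real.sqrt 10 + 6 * Real.sqrt 2)) ≤ 1 / 2) :
    ∀ p : Bond 3 (periodsT3 F K), ‖WL2.equiv ℂ (fun _ : Bond 3 (periodsT3 F K) => c₀) W₂ (DL2 F n K c₀ U₀ u) p‖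
      ≤ 2 * (exists_curved_localGradient.choose *
            (Mu * (2 + 2 * Real.sqrt 2 * (4 * ε₀ * (3 + 2457 * norm_bgOfCfg_axialT_sub_le.choose)) + (24 * Real.sqrt 10 + 48) * (48 * ε₀) ^ 2) + Mq)
          + 2 * Real.sqrt 2 * (48 * ε₀) * Mu) := by
  set M₀ : ℝ := exists_curved_localGradient.choose *
            (Mu * (2 + 2 * Real.sqrt 2 * (4 * ε₀ * (3 + 2457 * norm_bgOfCfg_axialT_sub_le.choose)) + (24 * Real.sqrt 10 + 48) * (48 * ε₀) ^ 2) + Mq)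
          + 2 * Real.sqrt 2 * (48 * ε₀) * Mu with hM₀
  have habs := weighted_sup_absorption (ι := Bond 3 (periodsT3 F K))
    (fun p => ‖WL2.equiv ℂ (fun _ : Bond 3 (periodsT3 F K) => c₀) W₂ (DL2 F n K c₀ U₀ u) p‖) (fun _ => (0 : ℝ)) (fun _ => M₀)
    (fun _ _ => True) (Cg := 1) (a := exists_curved_localGradient.choose * ((48 * ε₀) * (6 * Real.sqrt 2 * Real.sqrt 10 + 6 * Real.sqrt 2)))
    (M := M₀) (κ := 0) (D := 0) le_rfl zero_le_one (fun _ => norm_nonneg _) (fun _ _ _ => by simp)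
    (fun p Gb hGb => by
      rw [one_mul]
      exact perBond_gradient_le_of_sup F n K hε₀ hε1 U₀ hreg c₀ u q h hMu0 hMq0 hMu hMq hroom p Gb (fun p' => hGb p' trivial))
    (fun _ => by rw [zero_mul, neg_zero, Real.exp_zero, mul_one])
    (by rw [one_mul, zero_mul, Real.exp_zero, mul_one]; exact hsmall)
  intro p
  have := habs p
  rwa [zero_mul, neg_zero, Real.exp_zero, mul_one, mul_one] at this

end Summit.QuantumFields.YangMills.Theorems.Prop7MassiveSolutionGradientSup

end
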